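/-
Origin: expansion seat `planner-pub-hodgecm-prl1-g4-0`, handover #5a 2026-08-18T07:49:57Z (`HOME/pub-hodgecm-prl1-g4/lean/Prl1g4/AdelicUnitaryGroup.lean`, md5 25079bef, 301 lines);
landed by the gen-7 packager in gate run 26 as `HodgeCM/Automorphic/AdelicUnitaryGroup.lean` (verbatim).
-/
/-
HodgeCM / automorphic layer — publication cell pub-hodgecm, EXPANSION PROVER a-1 (pub-hodgecm-prl1-g4, HANDOVER #5a).
Imports only vendored / Mathlib / landed `HodgeCM.PerL34` modules (split off at pv06-g3's request 07:43:10Z so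
that torus-side consumers need not pull the Weil/theta chain).  Complete proofs, no new axioms, no hypotheses.
-/
import Literature.NumberTheory.Automorphic.AdeleRingTopology
import Literature.NumberTheory.Automorphic.GaloisActionAdeleRing
import Literature.NumberTheory.Automorphic.AdicCompletionCompact
import Summits.HodgeConjecture.HodgeCM.Vendored.Hermitian
import Summits.HodgeConjecture.HodgeCM.PerL34.FiniteAdeleLocallyCompact
import Summits.HodgeConjecture.HodgeCM.PerL34.RestrictedMeasureBorel_2
import Mathlib.Topology.Instances.Matrix

/-!
# The adelic unitary group `U(H)(𝔸_{L⁺}) ≤ GL_n(𝔸_L)` of a hermitian matrix over a CM field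

KERNEL content, Mathlib-style, no `HodgeCM.Universe` / theta-layer imports:

* §1–§3 **second countability of the adele ring** of a number field (and of `K_v`, `𝔸_K^∞`, `K_∞`),
  absent from Mathlib: countable value group ⇒ countably generated uniformity, `K` countable and
  dense ⇒ separable ⇒ `K_v` second countable; `Countable (HeightOneSpectrum (𝓞 K))` (Noetherian
  spans); the restricted product by pv09-g2's `RestrictedMeasure.secondCountableTopology`; `K_∞` by
  the vendored `infiniteAdeleRingHomeomorph`;
* §4 `GL n R` is a locally compact, second-countable, Hausdorff topological group for such rings;
* §5 `adelicUnitaryGroup L H ≤ GL n (AdeleRing (𝓞 L) L)` — the unitary group of the hermitian matrix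
  `H ∈ M_n(L)` with respect to the conjugation `c ⊗ id` of `𝔸_L = L ⊗_{L⁺} 𝔸_{L⁺}` (the vendored Galois
  action `AdeleRing.galRingEquiv (IsCMField.complexConj L)`), i.e. `U(H)(𝔸_{L⁺})`; it is CLOSED, hence
  locally compact, and second countable; its **rational points** `adelicUnitaryRat L H` = the image
  under `toAdeleGL` of the vendored `unitaryGroup (conjRingHomK L) H ≤ GL n L` = `U(H)(L⁺)`, proved
  **discrete** from the discreteness of `L ⊂ 𝔸_L` (vendored `AdeleRing.discreteTopology_principalSubgroup`,
  Cassels–Fröhlich II §14).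

The cocompact-lattice-model packaging, anisotropy and the END STATE over these groups are in
`AdelicUnitaryModel.lean` (HANDOVER #5b), which imports this file.
-/

set_option autoImplicit false

noncomputable section

open NumberField IsDedekindDomain TopologicalSpace Filter
open scoped RestrictedProduct Topology Uniformity Matrix

namespace HodgeCM.Adelic

/-! ## §1 Countability helpers -/

/-- (Ported verbatim from the HodgeCMPerL package; no docstring in the source.) -/
instance instCountableWithZero {α : Type*} [Countable α] : Countable (WithZero α) :=
  inferInstanceAs (Countable (Option α))

/-- (Ported verbatim from the HodgeCMPerL package; no docstring in the source.) -/
instance instCountableUnits {M : Type*} [Monoid M] [Countable M] : Countable Mˣ :=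
  Function.Injective.countable (f := (Units.val : Mˣ → M)) Units.val_injective

/-- A number field is countable (it is `ℚ^n` as a `ℚ`-vector space). -/
theorem countable_of_numberField (K : Type*) [Field K] [NumberField K] : Countable K :=
  Countable.of_equiv (Fin (Module.finrank ℚ K) → ℚ) (Module.finBasis ℚ K).equivFun.toEquiv.symm

/-- The ideals of a countable Noetherian ring form a countable set (each is the span of a finset). -/
theorem countable_ideal (R : Type*) [CommRing R] [IsNoetherianRing R] [Countable R] :
    Countable (Ideal R) := by
  refine Function.Surjective.countable (f := fun S : Finset R => Ideal.span (S : Set R)) fun I => ?_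
  obtain ⟨S, hS⟩ := (isNoetherian_def.mp (inferInstance : IsNoetherian R R)) I
  exact ⟨S, hS⟩

/-- A number field has countably many finite places. -/
instance countable_heightOneSpectrum (K : Type*) [Field K] [NumberField K] :
    Countable (HeightOneSpectrum (𝓞 K)) := by
  haveI := countable_of_numberField K
  haveI : Countable (𝓞 K) := Subtype.countable
  haveI : Countable (Ideal (𝓞 K)) := countable_ideal (𝓞 K)
  exact Function.Injective.countable (f := fun v : HeightOneSpectrum (𝓞 K) => v.asIdeal)
    fun v w h => HeightOneSpectrum.ext h

/-! ## §2 The local fields `K_v` are second countable -/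

section Local

variable (K : Type*) [Field K] [NumberField K]

/-- The uniformity of `K_v` is countably generated (basis indexed by the countable value group). -/
instance isCountablyGenerated_uniformity_adicCompletion (v : HeightOneSpectrum (𝓞 K)) :
    (𝓤 (v.adicCompletion K)).IsCountablyGenerated :=
  (Valued.hasBasis_uniformity (v.adicCompletion K) (WithZero (Multiplicative ℤ))).isCountablyGenerated

/-- `K` is dense in `K_v` and countable, so `K_v` is separable. -/
instance separableSpace_adicCompletion (v : HeightOneSpectrum (𝓞 K)) :
    SeparableSpace (v.adicCompletion K) := by
  haveI := countable_of_numberField K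
  exact ⟨⟨Set.range (algebraMap K (v.adicCompletion K)), Set.countable_range _,
    HeightOneSpectrum.denseRange_algebraMap K v⟩⟩

/-- **`K_v` is second countable.** -/
instance secondCountableTopology_adicCompletion (v : HeightOneSpectrum (𝓞 K)) :
    SecondCountableTopology (v.adicCompletion K) :=
  UniformSpace.secondCountable_of_separable (v.adicCompletion K)

/-! ## §3 The adele ring is second countable -/

/-- The finite adele ring `𝔸_K^∞ = Πʳ_v [K_v, 𝒪_v]` is second countable (countably many places,
second-countable factors, open `𝒪_v`; pv09-g2's `RestrictedMeasure.secondCountableTopology`). -/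
instance secondCountableTopology_finiteAdeleRing :
    SecondCountableTopology (FiniteAdeleRing (𝓞 K) K) :=
  HodgeCM.PerL34.RestrictedMeasure.secondCountableTopology
    (G := fun v : HeightOneSpectrum (𝓞 K) => v.adicCompletion K)
    (fun v => (v.adicCompletionIntegers K : Set (v.adicCompletion K)))
    (fun _ => Valued.isOpen_valuationSubring _)

/-- The infinite adele ring `K_∞ ≃ₜ ℝ^{r₁} × ℂ^{r₂}` is second countable. -/
instance secondCountableTopology_infiniteAdeleRing : SecondCountableTopology (InfiniteAdeleRing K) :=
  (Literature.NumberTheory.Automorphic.infiniteAdeleRingHomeomorph K).secondCountableTopology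

/-- **The adele ring `𝔸_K` is second countable.** -/
instance secondCountableTopology_adeleRing : SecondCountableTopology (AdeleRing (𝓞 K) K) :=
  inferInstanceAs (SecondCountableTopology (InfiniteAdeleRing K × FiniteAdeleRing (𝓞 K) K))

/-- The adele ring is Hausdorff. -/
instance t2Space_adeleRing : T2Space (AdeleRing (𝓞 K) K) :=
  inferInstanceAs (T2Space (InfiniteAdeleRing K × FiniteAdeleRing (𝓞 K) K))

end Local

/-! ## §4 `GL_n(𝔸_K)`: a locally compact, Hausdorff, second-countable topological group -/

section GLn

variable (n : Type) [Fintype n] [DecidableEq n] (R : Type*) [CommRing R] [TopologicalSpace R]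
  [IsTopologicalRing R]

/-- (Ported verbatim from the HodgeCMPerL package; no docstring in the source.) -/
instance secondCountableTopology_matrix [SecondCountableTopology R] :
    SecondCountableTopology (Matrix n n R) :=
  inferInstanceAs (SecondCountableTopology (n → n → R))

/-- (Ported verbatim from the HodgeCMPerL package; no docstring in the source.) -/
instance locallyCompactSpace_matrix [LocallyCompactSpace R] : LocallyCompactSpace (Matrix n n R) :=
  inferInstanceAs (LocallyCompactSpace (n → n → R))

/-- (Ported verbatim from the HodgeCMPerL package; no docstring in the source.) -/
instance t2Space_matrix [T2Space R] : T2Space (Matrix n n R) :=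
  inferInstanceAs (T2Space (n → n → R))

/-- `GL_n(R)` is second countable for a second-countable topological ring `R` (it embeds into
`M_n(R) × M_n(R)ᵐᵒᵖ`). -/
instance secondCountableTopology_GL [SecondCountableTopology R] : SecondCountableTopology (GL n R) := by
  haveI : SecondCountableTopology (Matrix n n R)ᵐᵒᵖ :=
    MulOpposite.opHomeomorph.symm.secondCountableTopology
  exact Units.isEmbedding_embedProduct.secondCountableTopology

/-- `GL_n(R)` is locally compact for a locally compact Hausdorff topological ring `R` (closed in
`M_n(R) × M_n(R)ᵐᵒᵖ`). -/
instance locallyCompactSpace_GL [LocallyCompactSpace R] [T2Space R] : LocallyCompactSpace (GL n R) := by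
  haveI : LocallyCompactSpace (Matrix n n R)ᵐᵒᵖ :=
    MulOpposite.opHomeomorph.symm.isClosedEmbedding.locallyCompactSpace
  exact Units.isClosedEmbedding_embedProduct.locallyCompactSpace

example [T2Space R] : T2Space (GL n R) := inferInstance
example : IsTopologicalGroup (GL n R) := inferInstance

end GLn




/-! ## §5 The adelic unitary group of a hermitian matrix over a CM field -/

section Unitary

open Literature.NumberTheory.Automorphic Literature.AlgebraicGeometry.ShimuraVarieties

variable (L : Type) [Field L] [NumberField L] [IsCMField L]
variable {n : Type} [Fintype n] [DecidableEq n]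

/-- Complex conjugation `c ⊗ id` of `𝔸_L = L ⊗_{L⁺} 𝔸_{L⁺}`: the vendored Galois action of
`c = IsCMField.complexConj L ∈ Gal(L/L⁺)` on `AdeleRing (𝓞 L) L`, as a ring endomorphism. -/
def adeleConj : AdeleRing (𝓞 L) L →+* AdeleRing (𝓞 L) L :=
  (AdeleRing.galRingEquiv (F := ↥(maximalRealSubfield L)) (IsCMField.complexConj L)).toRingHom

/-- (Ported verbatim from the HodgeCMPerL package; no docstring in the source.) -/
theorem adeleConj_apply (x : AdeleRing (𝓞 L) L) :
    adeleConj L x = (IsCMField.complexConj L) • x := rfl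

/-- (Ported verbatim from the HodgeCMPerL package; no docstring in the source.) -/
theorem continuous_adeleConj : Continuous (adeleConj L) :=
  AdeleRing.continuous_smul (↥(maximalRealSubfield L)) (IsCMField.complexConj L)

/-- `c ⊗ id` extends the CM conjugation of `L`: `(c x)_𝔸 = c_𝔸 (x_𝔸)`. -/
theorem adeleConj_algebraMap (x : L) :
    adeleConj L (algebraMap L (AdeleRing (𝓞 L) L) x) =
      algebraMap L (AdeleRing (𝓞 L) L) (conjRingHomK L x) :=
  AdeleRing.smul_algebraMap (↥(maximalRealSubfield L)) (IsCMField.complexConj L) x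

/-- **The adelic unitary group** `U(H)(𝔸_{L⁺}) ≤ GL_n(𝔸_L)` of a matrix `H ∈ M_n(L)`:
`{g | (c g)ᵀ · H · g = H}` (the vendored `unitaryGroup` over the ring `𝔸_L` with the involution `c ⊗ id`). -/
def adelicUnitaryGroup (H : Matrix n n L) : Subgroup (GL n (AdeleRing (𝓞 L) L)) :=
  unitaryGroup (adeleConj L) (H.map (algebraMap L (AdeleRing (𝓞 L) L)))

/-- (Ported verbatim from the HodgeCMPerL package; no docstring in the source.) -/
theorem mem_adelicUnitaryGroup_iff (H : Matrix n n L) (g : GL n (AdeleRing (𝓞 L) L)) :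
    g ∈ adelicUnitaryGroup L H ↔
      ((g : Matrix n n (AdeleRing (𝓞 L) L)).map (adeleConj L))ᵀ *
          H.map (algebraMap L (AdeleRing (𝓞 L) L)) * (g : Matrix n n (AdeleRing (𝓞 L) L)) =
        H.map (algebraMap L (AdeleRing (𝓞 L) L)) :=
  Iff.rfl

/-- `U(H)(𝔸_{L⁺})` is closed in `GL_n(𝔸_L)`. -/
theorem isClosed_adelicUnitaryGroup (H : Matrix n n L) :
    IsClosed (adelicUnitaryGroup L H : Set (GL n (AdeleRing (𝓞 L) L))) := by
  have h1 : Continuous fun g : GL n (AdeleRing (𝓞 L) L) => (g : Matrix n n (AdeleRing (𝓞 L) L)) :=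
    Units.continuous_val
  have hc : Continuous fun g : GL n (AdeleRing (𝓞 L) L) =>
      ((g : Matrix n n (AdeleRing (𝓞 L) L)).map (adeleConj L))ᵀ *
        H.map (algebraMap L (AdeleRing (𝓞 L) L)) * (g : Matrix n n (AdeleRing (𝓞 L) L)) :=
    ((h1.matrix_map (continuous_adeleConj L)).matrix_transpose.mul continuous_const).mul h1
  exact isClosed_eq hc continuous_const

/-- `U(H)(𝔸_{L⁺})` is locally compact (closed subgroup of the locally compact `GL_n(𝔸_L)`). -/
instance locallyCompactSpace_adelicUnitaryGroup (H : Matrix n n L) :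
    LocallyCompactSpace (adelicUnitaryGroup L H) := by
  haveI := locallyCompactSpace_adeleRing' L
  exact (isClosed_adelicUnitaryGroup L H).locallyCompactSpace

/-- `U(H)(𝔸_{L⁺})` is second countable (subgroup of the second-countable `GL_n(𝔸_L)`, §§3–4). -/
instance secondCountableTopology_adelicUnitaryGroup (H : Matrix n n L) :
    SecondCountableTopology (adelicUnitaryGroup L H) :=
  Topology.IsEmbedding.subtypeVal.secondCountableTopology

example (H : Matrix n n L) : IsTopologicalGroup (adelicUnitaryGroup L H) := inferInstance
example (H : Matrix n n L) : T2Space (adelicUnitaryGroup L H) := inferInstance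

/-- The diagonal embedding `GL_n(L) → GL_n(𝔸_L)`. -/
def toAdeleGL : GL n L →* GL n (AdeleRing (𝓞 L) L) :=
  Units.map (RingHom.mapMatrix (algebraMap L (AdeleRing (𝓞 L) L))).toMonoidHom

omit [IsCMField L] in
/-- (Ported verbatim from the HodgeCMPerL package; no docstring in the source.) -/
@[simp] theorem val_toAdeleGL (g : GL n L) :
    ((toAdeleGL L g : GL n (AdeleRing (𝓞 L) L)) : Matrix n n (AdeleRing (𝓞 L) L)) =
      (g : Matrix n n L).map (algebraMap L (AdeleRing (𝓞 L) L)) := rfl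

/-- (Ported verbatim from the HodgeCMPerL package; no docstring in the source.) -/
instance nontrivial_adeleRing : Nontrivial (AdeleRing (𝓞 L) L) :=
  inferInstanceAs (Nontrivial (InfiniteAdeleRing L × FiniteAdeleRing (𝓞 L) L))

omit [IsCMField L] in
/-- (Ported verbatim from the HodgeCMPerL package; no docstring in the source.) -/
theorem toAdeleGL_injective : Function.Injective (toAdeleGL (n := n) L) := by
  intro g h hgh
  have := congrArg (fun u : GL n (AdeleRing (𝓞 L) L) => (u : Matrix n n (AdeleRing (𝓞 L) L))) hgh
  simp only [val_toAdeleGL] at this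
  exact Units.ext (Matrix.map_injective (algebraMap L (AdeleRing (𝓞 L) L)).injective this)

/-- The rational unitary group `U(H)(L⁺) ≤ GL_n(L)` (vendored `unitaryGroup (conjRingHomK L) H`) maps
into `U(H)(𝔸_{L⁺})`. -/
theorem toAdeleGL_mem (H : Matrix n n L) {g : GL n L} (hg : g ∈ unitaryGroup (conjRingHomK L) H) :
    toAdeleGL L g ∈ adelicUnitaryGroup L H := by
  rw [mem_adelicUnitaryGroup_iff, val_toAdeleGL]
  rw [mem_unitaryGroup_iff] at hg
  have hmap : ((g : Matrix n n L).map (algebraMap L (AdeleRing (𝓞 L) L))).map (adeleConj L) =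
      ((g : Matrix n n L).map (conjRingHomK L)).map (algebraMap L (AdeleRing (𝓞 L) L)) := by
    rw [Matrix.map_map, Matrix.map_map]
    exact congrArg _ (funext fun x => adeleConj_algebraMap L x)
  rw [hmap, ← Matrix.transpose_map, ← Matrix.map_mul, ← Matrix.map_mul, hg]

/-- **The rational points** `U(H)(L⁺)` of the adelic unitary group: the image of
`unitaryGroup (conjRingHomK L) H ≤ GL_n(L)` under the diagonal embedding, as a subgroup of
`U(H)(𝔸_{L⁺})`. -/
def adelicUnitaryRat (H : Matrix n n L) : Subgroup (adelicUnitaryGroup L H) :=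
  ((unitaryGroup (conjRingHomK L) H).map (toAdeleGL L)).subgroupOf (adelicUnitaryGroup L H)

/-- (Ported verbatim from the HodgeCMPerL package; no docstring in the source.) -/
theorem mem_adelicUnitaryRat_iff (H : Matrix n n L) (γ : adelicUnitaryGroup L H) :
    γ ∈ adelicUnitaryRat L H ↔ ∃ g ∈ unitaryGroup (conjRingHomK L) H, toAdeleGL L g = γ := by
  simp only [adelicUnitaryRat, Subgroup.mem_subgroupOf, Subgroup.mem_map]

/-- Entries of a rational point are principal adeles. -/
theorem entry_mem_principalSubgroup (H : Matrix n n L) (γ : adelicUnitaryRat L H) (i j : n) :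
    ((γ : adelicUnitaryGroup L H) : GL n (AdeleRing (𝓞 L) L)).val i j ∈
      AdeleRing.principalSubgroup (𝓞 L) L := by
  obtain ⟨g, -, hg⟩ := (mem_adelicUnitaryRat_iff L H γ).1 γ.2
  refine ⟨(g : Matrix n n L) i j, ?_⟩
  have := congrArg (fun u : GL n (AdeleRing (𝓞 L) L) => (u : Matrix n n (AdeleRing (𝓞 L) L)) i j) hg
  simpa only [val_toAdeleGL, Matrix.map_apply] using this

/-- The entry map of the rational points into `M_n` of the (discrete) principal adeles. -/
def ratEntries (H : Matrix n n L) (γ : adelicUnitaryRat L H) :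
    Matrix n n (AdeleRing.principalSubgroup (𝓞 L) L) :=
  fun i j => ⟨_, entry_mem_principalSubgroup L H γ i j⟩

/-- (Ported verbatim from the HodgeCMPerL package; no docstring in the source.) -/
theorem continuous_ratEntries (H : Matrix n n L) : Continuous (ratEntries L H) := by
  refine continuous_pi fun i => continuous_pi fun j => ?_
  refine Continuous.subtype_mk ?_ _
  have h : Continuous fun γ : adelicUnitaryRat L H =>
      (((γ : adelicUnitaryGroup L H) : GL n (AdeleRing (𝓞 L) L)) : Matrix n n (AdeleRing (𝓞 L) L)) :=
    Units.continuous_val.comp (continuous_subtype_val.comp continuous_subtype_val)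
  exact h.matrix_elem i j

/-- (Ported verbatim from the HodgeCMPerL package; no docstring in the source.) -/
theorem ratEntries_injective (H : Matrix n n L) : Function.Injective (ratEntries L H) := by
  intro γ δ h
  apply Subtype.ext; apply Subtype.ext; apply Units.ext
  ext i j
  exact congrArg Subtype.val (congrFun (congrFun h i) j)

/-- **`U(H)(L⁺)` is discrete in `U(H)(𝔸_{L⁺})`** (because `L` is discrete in `𝔸_L`). -/
instance discreteTopology_adelicUnitaryRat (H : Matrix n n L) :
    DiscreteTopology (adelicUnitaryRat L H) := by
  haveI := AdeleRing.discreteTopology_principalSubgroup L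
  exact DiscreteTopology.of_continuous_injective (continuous_ratEntries L H) (ratEntries_injective L H)

end Unitary

end HodgeCM.Adelic
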